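import Summits.AtomisticToContinuum.HydrodynamicLimit.Theorems.CellForecastPressureDecay.Negative.IsolatedParticles

/-!
# `CellForecastPressureDecay`: the fixed-range floor — `R₀` must grow as `δ → 0`

Negative knowledge for the crux `AntiMazurCoboundaries.CellForecastPressureDecay`
(stmt-AtomisticToContinuum-13915), from `Cruxes/CellForecastPressureDecay/Disproof.lean` § 9
(seat refuter-cdisprove-stmt-AtomisticToContinuum-13915-g2-0, cycle 2). The first EXTENSIVE
(`n ≍ L³`) and dynamics-free negative lemma on the crux:

* `CellForecastPressureDecayFixedRange` — the crux with the quantifier block `∀ δ ∃ T ∃ R₀ ∀ R ≥ R₀`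
  replaced by `∃ R₀ ∀ δ ∃ T ∀ R ≥ R₀` ("one range serves every tolerance"; it implies the crux,
  `cellForecastPressureDecay_of_fixedRange`) — is FALSE (`cellForecastPressureDecay_false_fixedRange`).
* Mechanism (ISOLATED PARTICLES NEVER THERMALISE, `Negative/IsolatedParticles.lean`): on the event
  "particle `i` lies in the core (side `ℓ - R`) of the lattice cell `φ i`" for an injective assignment `φ`
  of particles to cells of side `ℓ`, all range-`R` clusters are singletons, every local forecast is free
  flight at EVERY horizon `T`, and the contribution of the event is exactly `Z⁻¹((ℓ-R)³ ∫ M e^{2g})ⁿ`; the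
  events are disjoint and there are `m³!/(m³-n)!` of them. With `Z ≤ L^{3n}`, `ℓ = K R`, `n = ⌊m³/K⌋`,
  `K = ⌈8(1+λ)/λ⌉ + 2`, `λ = ∫ e^{2g} dγ - 1 > 0` (`g = κ sin v₀ sin v₁`):
  `∫⁻ e^{2∑A_i} dP ≥ ((1 - 1/K)⁴ (1+λ))ⁿ ≥ (1 + λ/2)ⁿ > e^{δ L³}` for `δ = log(1+λ/2)/(4Kℓ³)`.
* Moral for provers: at fixed range the functional has a `T`-INDEPENDENT extensive floor
  `≍ λ⁵/R³` per volume; the order "`R₀` after `δ`" is load-bearing for a STATIC reason (dilute isolated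
  particles), not only for finite speed of influence (`R₀ ≫ T`); quantitatively `R₀(δ)³ ≳ λ⁵/δ`.
-/

open MeasureTheory Set Metric Filter ProbabilityTheory
open scoped ENNReal InnerProductSpace
open Literature.Analysis.FluidPDE Literature.MathematicalPhysics.KineticTheory

namespace Summit.AtomisticToContinuum.HydrodynamicLimit.Theorems

noncomputable section

namespace CellForecastPressureDecay

/-! ## § 9b The fixed-range variant of the crux is false -/

section FixedRange

variable {n m : ℕ}

/-- `CellForecastPressureDecay` with the range threshold `R₀` chosen BEFORE the tolerance `δ`: the
quantifier block `∀ δ ∃ T ∃ R₀ ∀ R ≥ R₀` of the crux is replaced by `∃ R₀ ∀ δ ∃ T ∀ R ≥ R₀`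
(everything else verbatim). A natural strengthening: "one range serves every tolerance". -/
def CellForecastPressureDecayFixedRange : Prop :=
  ∃ σ₀ : ℝ, 0 < σ₀ ∧ ∀ σ : ℝ, 0 < σ → σ < σ₀ → ∃ κ : ℝ, 0 < κ ∧ ∀ g : Literature.MathematicalPhysics.KineticTheory.V3 → ℝ, Continuous g → (∀ v, |g v| ≤ κ) → (∀ (c₀ c₂ : ℝ) (b : Literature.MathematicalPhysics.KineticTheory.V3), ∫ v, g v * (c₀ + inner ℝ b v + c₂ * ‖v‖ ^ 2) ∂(ProbabilityTheory.stdGaussian Literature.MathematicalPhysics.KineticTheory.V3) = 0) → ∃ R₀ : ℝ, 0 < R₀ ∧ ∀ δ : ℝ, 0 < δ → ∃ T : ℝ, 0 < T ∧ ∀ R : ℝ, R₀ ≤ R → ∃ L₀ : ℝ, 0 < L₀ ∧ ∀ L : ℝ, L₀ ≤ L → ∀ n : ℕ, (n : ℝ) ≤ 2 * L ^ 3 → ∀ (Ψ : (k : ℕ) → Literature.Analysis.FluidPDE.HardSphereFlow (Literature.Analysis.FluidPDE.Euclidean.geometry (Fin 3)) σ k) (c : ℝ), |c| ≤ 1 →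 ∫⁻ z, ENNReal.ofReal (Real.exp (2 * c * ∑ i : Fin n, T⁻¹ * ∫ t in (0 : ℝ)..T, g (Literature.Analysis.FluidPDE.localClusterState Ψ R t z i).2)) ∂(Literature.Analysis.FluidPDE.particleLaw (Ψ n) (Literature.Analysis.FluidPDE.canonicalDensity (Literature.Analysis.FluidPDE.Euclidean.geometry (Fin 3)) σ n (fun p => Set.indicator {x : Literature.MathematicalPhysics.KineticTheory.V3 | ∀ k, x k ∈ Set.Icc (0 : ℝ) L} (fun _ => (1 : ℝ)) p.1 * Literature.Analysis.FluidPDE.globalMaxwellian p.2))) ≤ ENNReal.ofReal (Real.exp (δ * L ^ 3))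

/-- Sanity: the fixed-range variant implies the crux (it is the crux with `∃ R₀` moved outward). [folklore] -/
theorem cellForecastPressureDecay_of_fixedRange (h : CellForecastPressureDecayFixedRange) :
    Summit.AtomisticToContinuum.HydrodynamicLimit.Theses.AntiMazurCoboundaries.CellForecastPressureDecay := by
  obtain ⟨σ₀, hσ₀, h⟩ := h
  refine ⟨σ₀, hσ₀, fun σ hσ hσ' => ?_⟩
  obtain ⟨κ, hκ, h⟩ := h σ hσ hσ'
  refine ⟨κ, hκ, fun g hg hgb horth δ hδ => ?_⟩
  obtain ⟨R₀, hR₀, h⟩ := h g hg hgb horth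
  obtain ⟨T, hT, h⟩ := h δ hδ
  exact ⟨T, hT, R₀, hR₀, h⟩

/-- **The fixed-range floor** (`R₀` must grow as `δ → 0`; dynamics-free and EXTENSIVE). With
`∃ R₀` before `∀ δ` the statement is false. Witness: `g = κ sin v₀ sin v₁` (admissible,
`J = ∫ e^{2g} dγ = 1 + λ > 1`), `R = max R₀ 1`, cells of side `ℓ = K R` (`K = ⌈8(1+λ)/λ⌉ + 2`),
`L = m ℓ`, `n = ⌊m³/K⌋` particles (density `1/(K ℓ³)`), `c = 1`, ANY horizon `T`. On the event
"particle `i` lies in the core (side `ℓ - R`) of cell `φ i`", `φ` injective, all range-`R` clusters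
are singletons, every forecast is free flight, and the window average of `g` is `g(v_i)`; summing
over the `m³!/(m³-n)!` assignments, `∫⁻ e^{2∑A_i} dP ≥ (m³-n)ⁿ ((ℓ-R)³ J)ⁿ / L^{3n} ≥ ((1-1/K)⁴ J)ⁿ
≥ (1 + λ/2)ⁿ > e^{δ L³}` for `δ = log(1+λ/2)/(4Kℓ³)`. So at fixed range the functional has a
`T`-independent extensive floor (isolated particles never thermalise): any proof must let
`R₀ → ∞` as `δ → 0` (quantitatively `R₀³ ≳ λ⁵/δ`), not only `R₀ ≫ T`. [folklore] -/
theorem cellForecastPressureDecay_false_fixedRange : ¬ CellForecastPressureDecayFixedRange := by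
  rintro ⟨σ₀, hσ₀, h⟩
  set σ : ℝ := min (σ₀ / 2) (3 / 16) with hσdef
  have hσpos : 0 < σ := by positivity
  have hσlt : σ < σ₀ := (min_le_left _ _).trans_lt (by linarith)
  have hσ' : σ ≤ 3 / 16 := min_le_right _ _
  obtain ⟨κ, hκ, h⟩ := h σ hσpos hσlt
  obtain ⟨R₀, hR₀, h⟩ := h (gW κ) (continuous_gW κ) (abs_gW_le hκ.le) (gW_orthogonal κ)
  -- the static exponential moment `J = ∫ e^{2g} dγ = 1 + λ > 1`
  set J : ℝ := ∫ v, Real.exp (2 * gW κ v) ∂stdGaussian V3 with hJdef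
  have hJ1 : 1 < J := one_lt_integral_exp_gW hκ.ne'
  set lam : ℝ := J - 1 with hlamdef
  have hlam : 0 < lam := by rw [hlamdef]; linarith
  have hJlam : J = 1 + lam := by rw [hlamdef]; ring
  have hJM : ∫ v, globalMaxwellian v * Real.exp (2 * gW κ v) = J := by
    rw [hJdef, integral_stdGaussian_eq_integral_mul_globalMaxwellian]
  -- geometry: range `R`, cell side `ℓ = K R`
  set R : ℝ := max R₀ 1 with hRdef
  have hR1 : 1 ≤ R := le_max_right _ _
  have hR0 : 0 ≤ R := by linarith
  have hσR : σ ≤ R := by linarith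
  set K : ℕ := ⌈8 * (1 + lam) / lam⌉₊ + 2 with hKdef
  have hK8 : 8 * (1 + lam) / lam ≤ K := by
    rw [hKdef]; push_cast; linarith [Nat.le_ceil (8 * (1 + lam) / lam)]
  have h8 : (8 : ℝ) ≤ 8 * (1 + lam) / lam := by
    rw [le_div_iff₀ hlam]; linarith
  have hK10 : (10 : ℝ) ≤ K := by
    rw [hKdef]; push_cast; linarith [Nat.le_ceil (8 * (1 + lam) / lam)]
  have hKpos : (0 : ℝ) < K := by linarith
  have hKne : (K : ℝ) ≠ 0 := hKpos.ne'
  set ℓ : ℝ := K * R with hℓdef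
  have hK1 : (1 : ℝ) ≤ K := by linarith
  have hℓ1 : 1 ≤ ℓ := by rw [hℓdef]; exact one_le_mul_of_one_le_of_one_le hK1 hR1
  have hℓ0 : 0 ≤ ℓ := by linarith
  have hℓpos : 0 < ℓ := by linarith
  have hRℓ : R ≤ ℓ := by rw [hℓdef]; exact le_mul_of_one_le_left hR0 hK1
  -- tolerance chosen AFTER `R₀` (this is what the fixed-range variant allows)
  have hlog : 0 < Real.log (1 + lam / 2) := Real.log_pos (by linarith)
  set δ : ℝ := Real.log (1 + lam / 2) / (4 * K * ℓ ^ 3) with hδdef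
  have hδ : 0 < δ := by positivity
  obtain ⟨T, hT, h⟩ := h δ hδ
  obtain ⟨L₀, hL₀, h⟩ := h R (le_max_left _ _)
  -- volume: `L = m ℓ`, `m ≥ 2K` cells per side
  set m : ℕ := ⌈L₀ / ℓ⌉₊ + 2 * K with hmdef
  have hm2K : (2 : ℝ) * K ≤ m := by
    rw [hmdef]; push_cast; linarith [Nat.cast_nonneg (α := ℝ) ⌈L₀ / ℓ⌉₊]
  have hm1 : (1 : ℝ) ≤ m := by linarith
  have hmpos : (0 : ℝ) < m := by linarith
  set L : ℝ := (m : ℝ) * ℓ with hLdef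
  have hLL₀ : L₀ ≤ L := by
    have h1 : L₀ / ℓ ≤ m := by
      rw [hmdef]; push_cast; linarith [Nat.le_ceil (L₀ / ℓ), (Nat.cast_nonneg K : (0 : ℝ) ≤ K)]
    rw [div_le_iff₀ hℓpos] at h1
    rw [hLdef]; linarith
  have hL1 : 1 ≤ L := by rw [hLdef]; exact one_le_mul_of_one_le_of_one_le hm1 hℓ1
  have hL0 : 0 ≤ L := by linarith
  have hL3 : L ^ 3 = (m : ℝ) ^ 3 * ℓ ^ 3 := by rw [hLdef]; ring
  -- particle number `n = ⌊m³/K⌋`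
  set M : ℕ := m ^ 3 with hMdef
  have hMR : (M : ℝ) = (m : ℝ) ^ 3 := by rw [hMdef]; push_cast; ring
  have hMpos : (0 : ℝ) < M := by rw [hMR]; positivity
  have hM2K : (2 : ℝ) * K ≤ M := by
    rw [hMR]; linarith [le_self_pow₀ hm1 three_ne_zero]
  set nn : ℕ := M / K with hndef
  have hnM : nn ≤ M := Nat.div_le_self _ _
  have hnle : (nn : ℝ) ≤ (M : ℝ) / K := by
    rw [le_div_iff₀ hKpos]; exact_mod_cast Nat.div_mul_le_self M K
  have hnge : (M : ℝ) / K - 1 ≤ nn := by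
    have h1 : ((nn * K + M % K : ℕ) : ℝ) = M := by exact_mod_cast Nat.div_add_mod' M K
    have h2 : ((M % K : ℕ) : ℝ) < K := by
      exact_mod_cast Nat.mod_lt M (by exact_mod_cast hKpos : 0 < K)
    push_cast at h1
    rw [div_sub_one hKne, div_le_iff₀ hKpos]
    linarith
  have hn2 : (nn : ℝ) ≤ 2 * L ^ 3 := by
    have h1 : (nn : ℝ) ≤ M := by exact_mod_cast hnM
    have h2 : (m : ℝ) ^ 3 ≤ L ^ 3 := by
      rw [hLdef]; exact pow_le_pow_left₀ hmpos.le (le_mul_of_one_le_right hmpos.le hℓ1) 3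
    rw [hMR] at h1
    linarith only [h1, h2, pow_nonneg hL0 3]
  set Ψ : (k : ℕ) → HardSphereFlow (Euclidean.geometry (Fin 3)) σ k :=
    fun k => (HardSphereFlow.nonempty_holds hσpos k).some with hΨ
  have key := h L hLL₀ nn hn2 Ψ 1 (by simp)
  rw [← cellRef_eq] at key
  -- the partition function
  set Z : ℝ := canonicalPartition (Euclidean.geometry (Fin 3)) σ nn (cellRef L) with hZdef
  have hZpos : 0 < Z := canonicalPartition_cell_pos hσ' hL1 hn2
  have hZle : Z ≤ (L ^ 3) ^ nn := canonicalPartition_cell_le σ hL0 nn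
  -- LOWER BOUND by the isolated-particles events
  set X : ℝ := (ℓ - R) ^ 3 * J with hXdef
  have hX0 : 0 ≤ X := mul_nonneg (pow_nonneg (by linarith) 3) (by linarith)
  have hlow : (Fintype.card (Fin nn ↪ (Fin 3 → Fin m)) : ℝ≥0∞) * ENNReal.ofReal (Z⁻¹ * X ^ nn) ≤
      ∫⁻ z, ENNReal.ofReal (Real.exp (2 * 1 * ∑ i : Fin nn, T⁻¹ * ∫ t in (0 : ℝ)..T,
        gW κ (localClusterState Ψ R t z i).2))
        ∂(particleLaw (Ψ nn) (canonicalDensity (Euclidean.geometry (Fin 3)) σ nn (cellRef L))) := by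
    calc (Fintype.card (Fin nn ↪ (Fin 3 → Fin m)) : ℝ≥0∞) * ENNReal.ofReal (Z⁻¹ * X ^ nn)
        = ∑ φ : Fin nn ↪ (Fin 3 → Fin m), ∫⁻ z, {z : Config nn (Fin 3) V3 | ∀ i, (z i).1 ∈ cellCore ℓ R (φ i)}.indicator
            (fun z => ENNReal.ofReal (Real.exp (2 * ∑ i, gW κ (z i).2))) z
            ∂(particleLaw (Ψ nn) (canonicalDensity (Euclidean.geometry (Fin 3)) σ nn (cellRef L))) := by
          rw [Finset.sum_congr rfl fun φ _ => lintegral_isoEvent hℓ0 hR0 hσR hRℓ hLdef (Ψ nn)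
              (continuous_gW κ) (abs_gW_le hκ.le) φ, Finset.sum_const, Finset.card_univ, nsmul_eq_mul,
            hJM, ← hXdef, ← hZdef]
      _ = ∫⁻ z, ∑ φ : Fin nn ↪ (Fin 3 → Fin m), {z : Config nn (Fin 3) V3 | ∀ i, (z i).1 ∈ cellCore ℓ R (φ i)}.indicator
            (fun z => ENNReal.ofReal (Real.exp (2 * ∑ i, gW κ (z i).2))) z
            ∂(particleLaw (Ψ nn) (canonicalDensity (Euclidean.geometry (Fin 3)) σ nn (cellRef L))) :=
          (lintegral_finsetSum _ fun φ _ => (measurable_expSum (continuous_gW κ)).indicator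
            (measurableSet_isoEvent ℓ R φ)).symm
      _ ≤ _ := lintegral_mono fun z => sum_indicator_le_cruxIntegrand hℓ0 hR0 hT.ne' Ψ (gW κ) z
  have hfin := hlow.trans key
  rw [← ENNReal.ofReal_natCast, ← ENNReal.ofReal_mul (Nat.cast_nonneg _),
    ENNReal.ofReal_le_ofReal_iff (Real.exp_pos _).le] at hfin
  -- hfin : card * (Z⁻¹ * X ^ nn) ≤ exp (δ * L ^ 3).  Now the real arithmetic.
  -- (i) the number of injective assignments
  have hcard : ((M : ℝ) - nn) ^ nn ≤ (Fintype.card (Fin nn ↪ (Fin 3 → Fin m)) : ℝ) := by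
    have h1 : Fintype.card (Fin nn ↪ (Fin 3 → Fin m)) = M.descFactorial nn := by
      rw [Fintype.card_embedding_eq]
      simp only [Fintype.card_fun, Fintype.card_fin]
      rw [hMdef]
    have h2 : (M - nn) ^ nn ≤ M.descFactorial nn :=
      (Nat.pow_le_pow_left (by omega) nn).trans (Nat.pow_sub_le_descFactorial M nn)
    have h3 : (((M - nn) ^ nn : ℕ) : ℝ) ≤ (M.descFactorial nn : ℝ) := by exact_mod_cast h2
    rw [h1]
    push_cast [Nat.cast_sub hnM] at h3
    exact h3
  -- (ii) the per-particle ratio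
  have hratio : (1 + lam / 2) ≤ ((M : ℝ) - nn) * X / L ^ 3 := by
    have hMn : (M : ℝ) * ((K - 1) / K) ≤ (M : ℝ) - nn := by
      have : (M : ℝ) * ((K - 1) / K) = M - M / K := by field_simp
      rw [this]; linarith
    have hX : X = ((K : ℝ) - 1) ^ 3 * R ^ 3 * J := by rw [hXdef, hℓdef]; ring
    have hL3' : L ^ 3 = (M : ℝ) * (K : ℝ) ^ 3 * R ^ 3 := by rw [hL3, hMR, hℓdef]; ring
    have hK1 : (0 : ℝ) ≤ (K : ℝ) - 1 := by linarith
    have hstep : (((K : ℝ) - 1) / K) ^ 4 * J ≤ ((M : ℝ) - nn) * X / L ^ 3 := by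
      rw [hX, hL3', le_div_iff₀ (by positivity)]
      have hJ0 : (0 : ℝ) ≤ J := by linarith
      have := mul_le_mul_of_nonneg_right hMn (by positivity : (0 : ℝ) ≤ ((K : ℝ) - 1) ^ 3 * R ^ 3 * J)
      calc (((K : ℝ) - 1) / K) ^ 4 * J * ((M : ℝ) * (K : ℝ) ^ 3 * R ^ 3)
          = (M : ℝ) * ((K - 1) / K) * (((K : ℝ) - 1) ^ 3 * R ^ 3 * J) := by
            field_simp
        _ ≤ ((M : ℝ) - nn) * (((K : ℝ) - 1) ^ 3 * R ^ 3 * J) := this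
    have hbern : 1 - 4 / (K : ℝ) ≤ (((K : ℝ) - 1) / K) ^ 4 := by
      have hb := one_add_mul_le_pow (a := -(1 / (K : ℝ))) (by
        have : 1 / (K : ℝ) ≤ 1 := by rw [div_le_one hKpos]; linarith
        linarith) 4
      have e1 : ((K : ℝ) - 1) / K = 1 + -(1 / (K : ℝ)) := by
        field_simp
        ring
      have e2 : (1 : ℝ) - 4 / K = 1 + (4 : ℕ) * -(1 / (K : ℝ)) := by
        push_cast
        ring
      rw [e1, e2]
      exact hb
    have hgain : 1 + lam / 2 ≤ (1 - 4 / (K : ℝ)) * J := by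
      rw [hJlam]
      have h4 : 4 * (1 + lam) / K ≤ lam / 2 := by
        rw [div_le_iff₀ hKpos]
        rw [div_le_iff₀ hlam] at hK8
        linarith
      have : (1 - 4 / (K : ℝ)) * (1 + lam) = 1 + lam - 4 * (1 + lam) / K := by ring
      rw [this]; linarith
    have hJ0 : (0 : ℝ) ≤ J := by linarith
    calc 1 + lam / 2 ≤ (1 - 4 / (K : ℝ)) * J := hgain
      _ ≤ (((K : ℝ) - 1) / K) ^ 4 * J := mul_le_mul_of_nonneg_right hbern hJ0
      _ ≤ ((M : ℝ) - nn) * X / L ^ 3 := hstep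
  -- (iii) assemble: card * Z⁻¹ * X^n ≥ ((M - n) X / L³)^n ≥ (1 + λ/2)^n
  have hL3pos : (0 : ℝ) < L ^ 3 := by positivity
  have hMn0 : (0 : ℝ) ≤ (M : ℝ) - nn := by
    have : (nn : ℝ) ≤ M := by exact_mod_cast hnM
    linarith
  have hmain : (1 + lam / 2) ^ nn ≤ (Fintype.card (Fin nn ↪ (Fin 3 → Fin m)) : ℝ) * (Z⁻¹ * X ^ nn) := by
    calc (1 + lam / 2) ^ nn ≤ (((M : ℝ) - nn) * X / L ^ 3) ^ nn :=
          pow_le_pow_left₀ (by linarith) hratio nn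
      _ = ((M : ℝ) - nn) ^ nn * (((L ^ 3) ^ nn)⁻¹ * X ^ nn) := by
          rw [div_pow, mul_pow]; ring
      _ ≤ ((M : ℝ) - nn) ^ nn * (Z⁻¹ * X ^ nn) := by
          refine mul_le_mul_of_nonneg_left (mul_le_mul_of_nonneg_right ?_ (pow_nonneg hX0 _))
            (pow_nonneg hMn0 _)
          exact inv_anti₀ hZpos hZle
      _ ≤ (Fintype.card (Fin nn ↪ (Fin 3 → Fin m)) : ℝ) * (Z⁻¹ * X ^ nn) :=
          mul_le_mul_of_nonneg_right hcard (mul_nonneg (inv_nonneg.2 hZpos.le) (pow_nonneg hX0 _))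
  -- (iv) but (1 + λ/2)^n > exp (δ L³) since n > M/(4K)
  have hexp : Real.exp (δ * L ^ 3) < (1 + lam / 2) ^ nn := by
    have e1 : (1 + lam / 2) ^ nn = Real.exp ((nn : ℝ) * Real.log (1 + lam / 2)) := by
      rw [Real.exp_nat_mul, Real.exp_log (by linarith)]
    rw [e1, Real.exp_lt_exp]
    have e2 : δ * L ^ 3 = Real.log (1 + lam / 2) * ((M : ℝ) / (4 * K)) := by
      rw [hδdef, hL3, hMR]; field_simp
    rw [e2]
    have h4 : (M : ℝ) / (4 * K) < nn := by
      have e3 : (M : ℝ) / K - 1 - M / (4 * K) = 3 * M / (4 * K) - 1 := by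
        field_simp
        ring
      have e4 : (1 : ℝ) < 3 * M / (4 * K) := by
        rw [one_lt_div (by positivity)]; linarith
      linarith
    rw [mul_comm (nn : ℝ)]
    exact mul_lt_mul_of_pos_left h4 hlog
  exact absurd (hmain.trans hfin) (not_le.2 hexp)

end FixedRange

end CellForecastPressureDecay

end

end Summit.AtomisticToContinuum.HydrodynamicLimit.Theorems
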